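import Summits.Ventures.PercRepro.Night2LocalCoverExtra

/-!
# PercRepro — the covering certificate and the coloop-member bound of the local form (night-2, gen 8)

Two general-`q` facts for the local form (LI_G) of the diagonal shadow condition (`Night2LocalForm.lean`):

* **`localShadowHall_of_cover_sum`** (THEOREM C, the covering certificate): if at every shadow set `S` with closure
  `G` the covering preimages `B` of `S` (the members with `S = B ∪ {z}`) satisfy `Σ_B 1/|E ∖ cl B| ≤ (q+1)/(q+2)`,
  then (LI_G) holds at `G`.  The fractional matching is `w(B, B ∪ {z}) = ((q+2)/(q+1)) / |E ∖ cl B|`: its row sum is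
  exactly the local demand `((q+2)/(q+1)) · |G ∖ cl B| / |E ∖ cl B|` (`card_coverSets`), and the hypothesis is the
  column bound.  It contains `localShadowHall_of_thin` (every preimage thin, `|E ∖ cl B| ≥ q + 2`, and at most
  `q + 1` preimages).
* **`card_coloopMembers_le`** (LEMMA A, the layer-0 bound of `proofs/NIGHT-2-local.md` §17): for `S ⊆ G`, the
  elements `y ∈ S` that are coloops of `M|G` (`y ∉ cl (G ∖ y)`) with `S ∖ y` a bottom set number at most `|E ∖ G|`.
  Proof: such `y` add rank over any subset of `G` avoiding them (`eRk_union_coloops`), so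
  `#Y + ρ(G ∖ S) = ρ(Y ∪ (G ∖ S)) ≤ ρ(G) = q + 1`; and for one such `y`,
  `E ∖ (S ∖ y) = (G ∖ S) ∪ {y} ∪ (E ∖ G)` has rank `q + 2 ≤ ρ(G ∖ S) + 1 + |E ∖ G|`.
  These `S ∖ y` are exactly the members with `|G ∖ cl(S ∖ y)| = 1` lying at distance one below `S`; the bound says
  that their total demand `#Y · ((q+2)/(q+1)) / (1 + |E ∖ G|)` on `S` stays below `1`.
-/

namespace PercRepro.Shadow

open Finset PerFlat ThmH

variable {α : Type*} [DecidableEq α] {M : Matroid α} [M.Finite]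

/-! ## Monotonicity in the family -/

/-- The shadow at `G` is monotone in the family. -/
theorem shadowAt_mono {p q : ℕ} {𝒜 𝒜' : Finset (Finset α)} (h : 𝒜 ⊆ 𝒜') (G : Finset α) :
    shadowAt M p q 𝒜 G ⊆ shadowAt M p q 𝒜' G := by
  intro S hS
  rw [mem_shadowAt, mem_shadow] at hS ⊢
  obtain ⟨⟨hY, B, hB, hBS⟩, hcl⟩ := hS
  exact ⟨⟨hY, B, h hB, hBS⟩, hcl⟩

/-- The members inside `G` are monotone in the family. -/
theorem membersIn_mono {𝒜 𝒜' : Finset (Finset α)} (h : 𝒜 ⊆ 𝒜') (G : Finset α) :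
    membersIn M 𝒜 G ⊆ membersIn M 𝒜' G := by
  intro B hB
  rw [mem_membersIn] at hB ⊢
  exact ⟨h hB.1, hB.2⟩

open scoped Classical in
/-- The covering preimages are monotone in the family. -/
theorem coverPreimages_mono {𝒜 𝒜' : Finset (Finset α)} (h : 𝒜 ⊆ 𝒜') (G S : Finset α) :
    coverPreimages M 𝒜 G S ⊆ coverPreimages M 𝒜' G S := by
  intro B hB
  rw [mem_coverPreimages] at hB ⊢
  exact ⟨membersIn_mono h G hB.1, hB.2⟩

/-! ## The covering certificate -/

open scoped Classical in
/-- The covering weight: `((q+2)/(q+1)) / |E ∖ cl B|` on every covering set `B ∪ {z}` of `B` at `G`, `0` elsewhere. -/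
noncomputable def coverWeight (M : Matroid α) [M.Finite] (q : ℕ) (G B S : Finset α) : ℚ :=
  if S ∈ coverSets M B G then (((q : ℚ) + 2) / ((q : ℚ) + 1)) / ((gr M \ clF M B).card : ℚ) else 0

open scoped Classical in
/-- The covering weight is nonnegative. -/
theorem coverWeight_nonneg (q : ℕ) (G B S : Finset α) : 0 ≤ coverWeight M q G B S := by
  unfold coverWeight
  split_ifs
  · positivity
  · exact le_refl _

open scoped Classical in
/-- The column sum of the covering weight at `S` is the sum over the covering preimages of `S`. -/
theorem sum_coverWeight_col (q : ℕ) (𝒜 : Finset (Finset α)) (G S : Finset α) :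
    ∑ B ∈ membersIn M 𝒜 G, coverWeight M q G B S =
      ∑ B ∈ coverPreimages M 𝒜 G S, (((q : ℚ) + 2) / ((q : ℚ) + 1)) / ((gr M \ clF M B).card : ℚ) := by
  unfold coverWeight coverPreimages
  rw [Finset.sum_filter]

open scoped Classical in
/-- The row sum of the covering weight of a member `B` over the shadow at `G` is its local demand. -/
theorem sum_coverWeight_row {q : ℕ} {𝒜 : Finset (Finset α)} (h𝒜 : 𝒜 ⊆ Uq M (q + 2) q) {G : Finset α}
    (hG : G ∈ flatsQ M (q + 1)) {B : Finset α} (hB : B ∈ membersIn M 𝒜 G) :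
    ∑ S ∈ shadowAt M (q + 2) q 𝒜 G, coverWeight M q G B S =
      (((q : ℚ) + 2) / ((q : ℚ) + 1)) * localWeight M B G := by
  have hBU : B ∈ Uq M (q + 2) q := h𝒜 (mem_membersIn.1 hB).1
  have hsub : coverSets M B G ⊆ shadowAt M (q + 2) q 𝒜 G := coverSets_subset_shadowAt h𝒜 hG hB
  unfold coverWeight
  rw [← Finset.sum_filter, Finset.filter_mem_eq_inter, Finset.inter_eq_right.2 hsub, Finset.sum_const,
    card_coverSets hBU, nsmul_eq_mul]
  unfold localWeight
  ring

open scoped Classical in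
/-- **THEOREM C — the covering certificate of the local form.**  If at every shadow set `S` with closure `G` the
covering preimages `B` of `S` satisfy `Σ_B 1/|E ∖ cl B| ≤ (q+1)/(q+2)`, then (LI_G) holds at `G`. -/
theorem localShadowHall_of_cover_sum {q : ℕ} {G : Finset α} (hG : G ∈ flatsQ M (q + 1))
    (h : ∀ S ∈ shadowAt M (q + 2) q (Uq M (q + 2) q) G,
      ∑ B ∈ coverPreimages M (Uq M (q + 2) q) G S, (1 : ℚ) / ((gr M \ clF M B).card : ℚ) ≤
        ((q : ℚ) + 1) / ((q : ℚ) + 2)) :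
    LocalShadowHall M q G := by
  apply localShadowHall_of_weights
  intro 𝒜 h𝒜
  refine ⟨coverWeight M q G, fun B S => coverWeight_nonneg q G B S, ?_, ?_⟩
  · intro S hS
    rw [sum_coverWeight_col]
    have hS' : S ∈ shadowAt M (q + 2) q (Uq M (q + 2) q) G := shadowAt_mono h𝒜 G hS
    have h1 : ∑ B ∈ coverPreimages M 𝒜 G S, (((q : ℚ) + 2) / ((q : ℚ) + 1)) / ((gr M \ clF M B).card : ℚ) ≤
        ∑ B ∈ coverPreimages M (Uq M (q + 2) q) G S,
          (((q : ℚ) + 2) / ((q : ℚ) + 1)) / ((gr M \ clF M B).card : ℚ) := by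
      apply Finset.sum_le_sum_of_subset_of_nonneg (coverPreimages_mono h𝒜 G S)
      intro B _ _
      positivity
    have h2 : ∑ B ∈ coverPreimages M (Uq M (q + 2) q) G S,
        (((q : ℚ) + 2) / ((q : ℚ) + 1)) / ((gr M \ clF M B).card : ℚ) =
        (((q : ℚ) + 2) / ((q : ℚ) + 1)) *
          ∑ B ∈ coverPreimages M (Uq M (q + 2) q) G S, (1 : ℚ) / ((gr M \ clF M B).card : ℚ) := by
      rw [Finset.mul_sum]
      apply Finset.sum_congr rfl
      intro B _
      ring
    have hq : (0 : ℚ) < (q : ℚ) + 1 := by positivity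
    have hq2 : (0 : ℚ) < (q : ℚ) + 2 := by positivity
    calc _ ≤ _ := h1
      _ = _ := h2
      _ ≤ (((q : ℚ) + 2) / ((q : ℚ) + 1)) * (((q : ℚ) + 1) / ((q : ℚ) + 2)) :=
          mul_le_mul_of_nonneg_left (h S hS') (by positivity)
      _ = 1 := by field_simp
  · intro B hB
    rw [sum_coverWeight_row h𝒜 hG hB]

/-! ## Coloops add rank -/

/-- An element `y ∈ G` with `y ∉ cl (G ∖ y)` adds one to the rank of any subset of `G ∖ y`. -/
theorem eRk_insert_of_notMem_clF_erase {G : Finset α} (hG : G ⊆ gr M) {y : α} (hyG : y ∈ G)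
    (hy : y ∉ clF M (G.erase y)) {X : Finset α} (hX : X ⊆ G.erase y) :
    M.eRk ((insert y X : Finset α) : Set α) = M.eRk (X : Set α) + 1 := by
  rw [Finset.coe_insert]
  apply Matroid.eRk_insert_eq_add_one
  refine ⟨by rw [← coe_gr]; exact_mod_cast hG hyG, ?_⟩
  intro hcl
  apply hy
  rw [← Finset.mem_coe, coe_clF]
  exact M.closure_subset_closure (by exact_mod_cast hX) hcl

/-- **Coloops of `M|G` add rank**: if every `y ∈ Y` satisfies `y ∈ G`, `y ∉ cl (G ∖ y)`, and `X ⊆ G` is disjoint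
from `Y`, then `ρ(Y ∪ X) = #Y + ρ(X)`. -/
theorem eRk_union_coloops {G : Finset α} (hG : G ⊆ gr M) (Y : Finset α)
    (hY : ∀ y ∈ Y, y ∈ G ∧ y ∉ clF M (G.erase y)) {X : Finset α} (hX : X ⊆ G) (hdisj : Disjoint Y X) :
    M.eRk ((Y ∪ X : Finset α) : Set α) = (Y.card : ℕ∞) + M.eRk (X : Set α) := by
  induction Y using Finset.induction_on with
  | empty => simp
  | insert y Y hyY ih =>
    have hy := hY y (Finset.mem_insert_self _ _)
    have hY' : ∀ y' ∈ Y, y' ∈ G ∧ y' ∉ clF M (G.erase y') :=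
      fun y' hy' => hY y' (Finset.mem_insert_of_mem hy')
    have hdisj' : Disjoint Y X := Finset.disjoint_of_subset_left (Finset.subset_insert _ _) hdisj
    have hyX : y ∉ X := Finset.disjoint_left.1 hdisj (Finset.mem_insert_self _ _)
    have hsub : Y ∪ X ⊆ G.erase y := by
      intro e he
      rw [Finset.mem_erase]
      rw [Finset.mem_union] at he
      rcases he with he | he
      · exact ⟨fun h => hyY (h ▸ he), (hY' e he).1⟩
      · exact ⟨fun h => hyX (h ▸ he), hX he⟩
    rw [Finset.insert_union, eRk_insert_of_notMem_clF_erase hG hy.1 hy.2 hsub, ih hY' hdisj',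
      Finset.card_insert_of_notMem hyY]
    push_cast
    ring

/-! ## LEMMA A — the coloop members below a set -/

open scoped Classical in
/-- The coloop members below `S` at `G`: the `y ∈ S` that are coloops of `M|G` with `S ∖ y` a bottom set. -/
noncomputable def coloopMembers (M : Matroid α) [M.Finite] (q : ℕ) (G S : Finset α) : Finset α :=
  S.filter (fun y => y ∉ clF M (G.erase y) ∧ S.erase y ∈ Uq M (q + 2) q)

open scoped Classical in
/-- Membership in `coloopMembers`. -/
theorem mem_coloopMembers {q : ℕ} {G S : Finset α} {y : α} :
    y ∈ coloopMembers M q G S ↔ y ∈ S ∧ y ∉ clF M (G.erase y) ∧ S.erase y ∈ Uq M (q + 2) q := by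
  unfold coloopMembers
  rw [Finset.mem_filter]

omit [DecidableEq α] [M.Finite] in
/-- A finite-set rank is finite. -/
theorem eRk_ne_top (X : Finset α) : M.eRk (X : Set α) ≠ ⊤ := by
  have h : M.eRk (X : Set α) ≤ ((X.card : ℕ) : ℕ∞) := by
    have := M.eRk_le_encard (X : Set α)
    rwa [Set.encard_coe_eq_coe_finsetCard] at this
  exact ne_top_of_le_ne_top (ENat.coe_ne_top _) h

open scoped Classical in
/-- **LEMMA A.**  For `S ⊆ G`, `G` a rank-`(q+1)` flat, the coloop members below `S` number at most `|E ∖ G|`. -/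
theorem card_coloopMembers_le {q : ℕ} {G : Finset α} (hG : G ∈ flatsQ M (q + 1)) {S : Finset α} (hS : S ⊆ G) :
    (coloopMembers M q G S).card ≤ (gr M \ G).card := by
  have hGE : G ⊆ gr M := (mem_flatsQ.1 hG).1
  have hGr : M.eRk (G : Set α) = ((q + 1 : ℕ) : ℕ∞) := (mem_flatsQ.1 hG).2.2
  set Y := coloopMembers M q G S with hYdef
  have hYS : Y ⊆ S := Finset.filter_subset _ _
  have hYG : ∀ y ∈ Y, y ∈ G ∧ y ∉ clF M (G.erase y) :=
    fun y hy => ⟨hS (hYS hy), (mem_coloopMembers.1 hy).2.1⟩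
  -- #Y + ρ(G ∖ S) = ρ(Y ∪ (G ∖ S)) ≤ ρ(G) = q + 1
  have hdisj : Disjoint Y (G \ S) := by
    rw [Finset.disjoint_left]
    intro y hy hyGS
    exact (Finset.mem_sdiff.1 hyGS).2 (hYS hy)
  have h1 : (Y.card : ℕ∞) + M.eRk ((G \ S : Finset α) : Set α) ≤ ((q + 1 : ℕ) : ℕ∞) := by
    rw [← eRk_union_coloops hGE Y hYG Finset.sdiff_subset hdisj, ← hGr]
    apply M.eRk_mono
    intro e he
    rw [Finset.mem_coe, Finset.mem_union] at he
    rcases he with he | he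
    · exact_mod_cast (hYG e he).1
    · exact_mod_cast (Finset.mem_sdiff.1 he).1
  by_cases hY : Y = ∅
  · rw [hY]; simp
  obtain ⟨y, hy⟩ := Finset.nonempty_iff_ne_empty.2 hY
  have hymem := mem_coloopMembers.1 hy
  have hyS : y ∈ S := hymem.1
  -- E ∖ (S ∖ y) = insert y ((G ∖ S) ∪ (E ∖ G)) has rank q + 2
  have hrank : M.eRk ((gr M \ S.erase y : Finset α) : Set α) = ((q + 2 : ℕ) : ℕ∞) := (mem_Uq.1 hymem.2.2).2.2
  have hset : gr M \ S.erase y = insert y ((G \ S) ∪ (gr M \ G)) := by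
    ext e
    simp only [Finset.mem_sdiff, Finset.mem_erase, Finset.mem_insert, Finset.mem_union]
    constructor
    · rintro ⟨heE, he⟩
      by_cases hey : e = y
      · exact Or.inl hey
      · right
        have heS : e ∉ S := fun h => he ⟨hey, h⟩
        by_cases heG : e ∈ G
        · exact Or.inl ⟨heG, heS⟩
        · exact Or.inr ⟨heE, heG⟩
    · rintro (rfl | ⟨heG, heS⟩ | ⟨heE, heG⟩)
      · exact ⟨hGE (hS hyS), fun h => h.1 rfl⟩
      · exact ⟨hGE heG, fun h => heS h.2⟩
      · exact ⟨heE, fun h => heG (hS h.2)⟩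
  have h2 : ((q + 2 : ℕ) : ℕ∞) ≤ M.eRk ((G \ S : Finset α) : Set α) + ((gr M \ G).card : ℕ∞) + 1 := by
    rw [← hrank, hset, Finset.coe_insert]
    calc M.eRk (insert y (((G \ S) ∪ (gr M \ G) : Finset α) : Set α))
        ≤ M.eRk ((((G \ S) ∪ (gr M \ G) : Finset α) : Set α)) + 1 := M.eRk_insert_le_add_one _ _
      _ ≤ M.eRk ((G \ S : Finset α) : Set α) + M.eRk ((gr M \ G : Finset α) : Set α) + 1 := by
          rw [Finset.coe_union]
          gcongr
          exact M.eRk_union_le_eRk_add_eRk _ _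
      _ ≤ M.eRk ((G \ S : Finset α) : Set α) + ((gr M \ G).card : ℕ∞) + 1 := by
          gcongr
          have := M.eRk_le_encard ((gr M \ G : Finset α) : Set α)
          rwa [Set.encard_coe_eq_coe_finsetCard] at this
  -- arithmetic in ℕ
  obtain ⟨r, hr⟩ := ENat.ne_top_iff_exists.1 (eRk_ne_top (M := M) (G \ S))
  rw [← hr] at h1 h2
  have h1' : Y.card + r ≤ q + 1 := by exact_mod_cast h1
  have h2' : q + 2 ≤ r + (gr M \ G).card + 1 := by exact_mod_cast h2
  omega

end PercRepro.Shadow
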